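import Summits.NavierStokesRegularity.NavierStokesRegularity.Theorems.QuarterLogPincerAnalyticWindowDefs
import Summits.NavierStokesRegularity.NavierStokesRegularity.Theorems.QuarterLogPincerTypeIQuantSubcubicExpFlatWindowExplicitWindow
import Summits.NavierStokesRegularity.NavierStokesRegularity.Theorems.QuarterLogPincerTypeIQuantSubcubicExpFlatWindowAnnulusPressure
import Summits.NavierStokesRegularity.NavierStokesRegularity.Theorems.TypeIQuantSubcubicExp.Negative.AnalyticWindowRungTyped
import HarnessLib

/-!
# The `analytic_window` ∃-rung WITH DEFINING CONJUNCTS, as typed, is Chae–Wolf 1.3 modulo S2 — refuter side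

Crux `stmt-NavierStokesRegularity-24077` (`QuarterLogPincer.TypeIQuantSubcubicExp`), rung line
`Cruxes/TypeIQuantSubcubicExp/Lines/analytic_window.lean` (ns-idea-7 g6, v4 sha12 `2d3691688f08`; one `sorry` =
S2a `stub_slabJets`).  This file completes the remark left open in `AnalyticWindowRungTyped` (p644572, the v2
RANGES form) and `ExplicitWindowRungTyped` (p645908, the `flat_window` rung): the v3/v4 rung of record

  `analyticWindow_rung_exists : ∀ C₀ > 0, ∃ δ₀ θ C₁ Cp s₀, OneSliceThresholdAt C₀ δ₀ Cp s₀ ∧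
     AnnulusPressure C₀ Cp ∧ ProfileGevreyBound C₀ (2e^{s₀/2}) C₁ θ ∧ (ranges) ∧
     ∀ c, 1 < c → c ≤ exp(θ/(4 log(9C₁/(θδ₀)))) → (classical ancient ∧ c-DSS ∧ HasTypeIDecay C₀ ⇒ u ≡ 0)`

(«∃-form WITH DEFINING CONJUNCTS, critic P1's fix») could not be audited in the kernel while
`OneSliceThresholdAt` / `ProfileGevreyBound` lived only in the crux work-file; they are now tree objects
(`QuarterLogPincerAnalyticWindowDefs`, p648220, texts verbatim, landed by ns-tc-p1 g5).

FINDING (kernel-checked below, real arithmetic + two monotonicities).  Write `S2∃` for the conclusion of the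
line's S2 (`profileGevreyBound_exists : ∀ C₀ > 0, ∀ R > 0, ∃ C₁ ≥ 1, ∃ θ ∈ (0,1], ProfileGevreyBound C₀ R C₁ θ`,
proved in the line from the open stub S2a).  Then, AS TYPED,

  `S2∃ → (analyticWindow_rung_exists-statement ↔ Literature.Analysis.FluidPDE.chaeWolf2017_removing_dss)`

(`analyticWindowRungExists_iff_chaeWolf`), and since Chae–Wolf 1.3 is a tree THEOREM
(`chaeWolf2017_removing_dss_holds`), `S2∃ →` the ∃-rung (`analyticWindowRungExists_of_profileGevreyBoundExists`)
WITHOUT S1 (`gevreyFlatness_holds`), without the slice dictionary, without `window_comparison` /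
`flatOnBall_of_window` / the apex–Liouville chain.  Mechanism: the data predicates are MONOTONE —
`OneSliceThresholdAt.mono` (a smaller `δ₀` is still a threshold) — and the displayed window
`exp(θ/(4 log(9C₁/(θδ₀))))` tends to `1` as `δ₀ → 0⁺`; so after inhabiting the conjuncts (tree:
`oneSliceThreshold_exists`, `stub_annulusPressure`, `oneSliceThresholdAt_of`; hypothesis: `S2∃`) one shrinks `δ₀`
to `min δ₁ 1 (exp(−θ/(2 log c₁)))`, which pushes the window below `√c₁ < c₁`, Chae–Wolf's qualitative factor.
Conversely the ∃-rung gives Chae–Wolf with `c₁ :=` the displayed window (`one_lt_analyticWindow`, p644572).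
Tying `δ₀, θ, C₁` to their defining predicates therefore does NOT change the typed strength found for the ranges
form in p644572: an `∃`-closed window rung over monotone data predicates is Chae–Wolf 1.3 plus inhabitation.

READING for the lead / critics / line owner (fairness): the line's quantitative content is real and lives in
its PARAMETRIC theorem `analyticWindow_rung` (∀-data, explicit window FUNCTION `(δ₀, C₁, θ) ↦
exp(θ/(4 log(9C₁/(θδ₀))))`, sorry-free, being re-homed to `Theorems/` by ns-tc-p1 g5) and in
`window_comparison`; what this file says is only that the ∃-closure of record cannot carry that content at the
typed level, whichever conjuncts are displayed, unless the data are PINNED (canonical/least threshold, explicit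
numeric constants) rather than ∃-bound.  S2/S2a remain Literature-grade regularity filings (class-uniform
analyticity jets of Type-I ancient mild solutions); they buy no typed statement about the crux.

Nothing here asserts S3, the crux 24077, or any Theses statement; no summit statement is proved by this file;
NS regularity is OPEN; the near-one cell of the DSS census stays «∃ λ₀(C₀) > 1, non-numeric» (READOUT v2: 0/5
constants pinned).
-/

-- the summit and its single sub-problem share the name (CONVENTIONS §1), as in every Theorems file
set_option linter.dupNamespace false

namespace Summit.NavierStokesRegularity.NavierStokesRegularity.Theorems.TypeIQuantSubcubicExp.Negative

open Set
open Literature.Analysis Literature.Analysis.FluidPDE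
open Summit.NavierStokesRegularity.NavierStokesRegularity.Cruxes.TypeIQuantSubcubicExp.FlatWindow
open Summit.NavierStokesRegularity.NavierStokesRegularity.Cruxes.TypeIQuantSubcubicExp.AnalyticWindow

/-! ### 1. Arithmetic: shrinking the threshold closes the window -/

/-- If `δ₀ ≤ exp(−θ/(2 log c₁))`, `0 < θ ≤ 9C₁`, `1 < c₁`, then the displayed window is at most `√c₁`, hence
`< c₁`. [folklore] -/
theorem analyticWindow_lt_of_small_threshold {δ₀ θ C₁ c₁ : ℝ} (hδ₀ : 0 < δ₀) (hθ : 0 < θ) (hθC : θ ≤ 9 * C₁)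
    (hc₁ : 1 < c₁) (hsmall : δ₀ ≤ Real.exp (-(θ / (2 * Real.log c₁)))) :
    Real.exp (θ / (4 * Real.log (9 * C₁ / (θ * δ₀)))) < c₁ := by
  have hlc : 0 < Real.log c₁ := Real.log_pos hc₁
  -- `9C₁/(θδ₀) ≥ 1/δ₀ ≥ exp(θ/(2 log c₁))`
  have h1 : Real.exp (θ / (2 * Real.log c₁)) ≤ 1 / δ₀ := by
    rw [le_div_iff₀ hδ₀]
    calc Real.exp (θ / (2 * Real.log c₁)) * δ₀
        ≤ Real.exp (θ / (2 * Real.log c₁)) * Real.exp (-(θ / (2 * Real.log c₁))) := by gcongr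
      _ = 1 := by rw [← Real.exp_add, add_neg_cancel, Real.exp_zero]
  have h2 : 1 / δ₀ ≤ 9 * C₁ / (θ * δ₀) := by
    rw [div_le_div_iff₀ hδ₀ (mul_pos hθ hδ₀)]
    nlinarith
  have hL : θ / (2 * Real.log c₁) ≤ Real.log (9 * C₁ / (θ * δ₀)) := by
    have h3 := Real.log_le_log (Real.exp_pos _) (h1.trans h2)
    rwa [Real.log_exp] at h3
  have hLpos : 0 < Real.log (9 * C₁ / (θ * δ₀)) := lt_of_lt_of_le (by positivity) hL
  have hw : θ / (4 * Real.log (9 * C₁ / (θ * δ₀))) ≤ Real.log c₁ / 2 := by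
    rw [div_le_iff₀ (by positivity)]
    have h4 := (div_le_iff₀ (by positivity : (0 : ℝ) < 2 * Real.log c₁)).mp hL
    nlinarith
  calc Real.exp (θ / (4 * Real.log (9 * C₁ / (θ * δ₀))))
      ≤ Real.exp (Real.log c₁ / 2) := Real.exp_le_exp.mpr hw
    _ < Real.exp (Real.log c₁) := Real.exp_lt_exp.mpr (by linarith)
    _ = c₁ := Real.exp_log (by linarith)

/-! ### 2. The ∃-rung with defining conjuncts ⟺ Chae–Wolf 1.3 (modulo S2) -/

-- The rung statement below is, token for token, the type of the line's `analyticWindow_rung_exists` (v4); the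
-- hypothesis `hS2` is, token for token, the type of the line's `profileGevreyBound_exists` (S2's conclusion).

/-- **The ∃-rung as typed ⇒ Chae–Wolf 1.3** (`c₁ :=` the displayed window; the three data predicates are not
used). [folklore] -/
theorem chaeWolf_of_analyticWindowRungExists
    (h : ∀ C₀ : ℝ, 0 < C₀ → ∃ δ₀ θ C₁ Cp s₀ : ℝ,
      OneSliceThresholdAt C₀ δ₀ Cp s₀ ∧ AnnulusPressure C₀ Cp ∧
      ProfileGevreyBound C₀ (2 * Real.exp (s₀ / 2)) C₁ θ ∧
      0 < δ₀ ∧ δ₀ ≤ 1 ∧ 0 < θ ∧ θ ≤ 1 ∧ 1 ≤ C₁ ∧ 0 < Cp ∧ 1 ≤ s₀ ∧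
      ∀ c : ℝ, 1 < c → c ≤ Real.exp (θ / (4 * Real.log (9 * C₁ / (θ * δ₀)))) →
        ∀ (u : ℝ → EuclideanSpace ℝ (Fin 3) → EuclideanSpace ℝ (Fin 3))
          (p : ℝ → EuclideanSpace ℝ (Fin 3) → ℝ),
          IsClassicalNSSolutionOn (Iio 0) 1 0 u p → IsDiscretelySelfSimilar c u → HasTypeIDecay C₀ u →
          ∀ t < 0, ∀ x, u t x = 0) :
    chaeWolf2017_removing_dss := by
  intro C₀ hC₀
  obtain ⟨δ₀, θ, C₁, Cp, s₀, -, -, -, hδ₀, hδ₁, hθ, hθ1, hC₁, -, -, hW⟩ := h C₀ hC₀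
  refine ⟨Real.exp (θ / (4 * Real.log (9 * C₁ / (θ * δ₀)))), one_lt_analyticWindow hδ₀ hδ₁ hθ hθ1 hC₁, ?_⟩
  intro c hc hcc u p hsol hdss hdec
  exact hW c hc hcc.le u p hsol hdss hdec

/-- **Chae–Wolf 1.3 + S2's conclusion ⇒ the ∃-rung as typed**: inhabit the conjuncts (tree
`oneSliceThreshold_exists`, `stub_annulusPressure`, `oneSliceThresholdAt_of`; hypothesis `hS2`), then SHRINK
the threshold (`OneSliceThresholdAt.mono`) until the displayed window is `< c₁`
(`analyticWindow_lt_of_small_threshold`).  No S1, no dictionary, no apex–Liouville chain. [folklore] -/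
theorem analyticWindowRungExists_of_chaeWolf (hcw : chaeWolf2017_removing_dss)
    (hS2 : ∀ C₀ : ℝ, 0 < C₀ → ∀ R : ℝ, 0 < R → ∃ C₁ θ : ℝ, 1 ≤ C₁ ∧ 0 < θ ∧ θ ≤ 1 ∧
      ProfileGevreyBound C₀ R C₁ θ) :
    ∀ C₀ : ℝ, 0 < C₀ → ∃ δ₀ θ C₁ Cp s₀ : ℝ,
      OneSliceThresholdAt C₀ δ₀ Cp s₀ ∧ AnnulusPressure C₀ Cp ∧
      ProfileGevreyBound C₀ (2 * Real.exp (s₀ / 2)) C₁ θ ∧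
      0 < δ₀ ∧ δ₀ ≤ 1 ∧ 0 < θ ∧ θ ≤ 1 ∧ 1 ≤ C₁ ∧ 0 < Cp ∧ 1 ≤ s₀ ∧
      ∀ c : ℝ, 1 < c → c ≤ Real.exp (θ / (4 * Real.log (9 * C₁ / (θ * δ₀)))) →
        ∀ (u : ℝ → EuclideanSpace ℝ (Fin 3) → EuclideanSpace ℝ (Fin 3))
          (p : ℝ → EuclideanSpace ℝ (Fin 3) → ℝ),
          IsClassicalNSSolutionOn (Iio 0) 1 0 u p → IsDiscretelySelfSimilar c u → HasTypeIDecay C₀ u →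
          ∀ t < 0, ∀ x, u t x = 0 := by
  intro C₀ hC₀
  obtain ⟨c₁, hc₁, hW⟩ := hcw C₀ hC₀
  obtain ⟨δ₁, hT⟩ := oneSliceThreshold_exists C₀ hC₀
  obtain ⟨Cp, hCp, hP⟩ := stub_annulusPressure C₀ hC₀
  obtain ⟨s₀, hs₀, hTat⟩ := oneSliceThresholdAt_of hT hCp
  have hR : 0 < 2 * Real.exp (s₀ / 2) := by positivity
  obtain ⟨C₁, θ, hC₁, hθ, hθ1, hG⟩ := hS2 C₀ hC₀ (2 * Real.exp (s₀ / 2)) hR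
  -- shrink the threshold
  set δ₀ : ℝ := min (min δ₁ 1) (Real.exp (-(θ / (2 * Real.log c₁)))) with hδdef
  have hδ₀ : 0 < δ₀ := lt_min (lt_min hT.1 zero_lt_one) (Real.exp_pos _)
  have hδle1 : δ₀ ≤ 1 := (min_le_left _ _).trans (min_le_right _ _)
  have hδleδ₁ : δ₀ ≤ δ₁ := (min_le_left _ _).trans (min_le_left _ _)
  have hsmall : δ₀ ≤ Real.exp (-(θ / (2 * Real.log c₁))) := min_le_right _ _
  have hTat' : OneSliceThresholdAt C₀ δ₀ Cp s₀ := hTat.mono hδleδ₁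
  refine ⟨δ₀, θ, C₁, Cp, s₀, hTat', hP, hG, hδ₀, hδle1, hθ, hθ1, hC₁, hCp, hs₀, ?_⟩
  intro c hc hcc u p hsol hdss hdec
  have hθC : θ ≤ 9 * C₁ := by linarith
  exact hW c hc (lt_of_le_of_lt hcc (analyticWindow_lt_of_small_threshold hδ₀ hθ hθC hc₁ hsmall))
    u p hsol hdss hdec

/-- **Modulo S2's conclusion, the ∃-rung with defining conjuncts AS TYPED ⟺ Chae–Wolf 2017 Thm 1.3.**
[folklore] -/
theorem analyticWindowRungExists_iff_chaeWolf
    (hS2 : ∀ C₀ : ℝ, 0 < C₀ → ∀ R : ℝ, 0 < R → ∃ C₁ θ : ℝ, 1 ≤ C₁ ∧ 0 < θ ∧ θ ≤ 1 ∧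
      ProfileGevreyBound C₀ R C₁ θ) :
    (∀ C₀ : ℝ, 0 < C₀ → ∃ δ₀ θ C₁ Cp s₀ : ℝ,
      OneSliceThresholdAt C₀ δ₀ Cp s₀ ∧ AnnulusPressure C₀ Cp ∧
      ProfileGevreyBound C₀ (2 * Real.exp (s₀ / 2)) C₁ θ ∧
      0 < δ₀ ∧ δ₀ ≤ 1 ∧ 0 < θ ∧ θ ≤ 1 ∧ 1 ≤ C₁ ∧ 0 < Cp ∧ 1 ≤ s₀ ∧
      ∀ c : ℝ, 1 < c → c ≤ Real.exp (θ / (4 * Real.log (9 * C₁ / (θ * δ₀)))) →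
        ∀ (u : ℝ → EuclideanSpace ℝ (Fin 3) → EuclideanSpace ℝ (Fin 3))
          (p : ℝ → EuclideanSpace ℝ (Fin 3) → ℝ),
          IsClassicalNSSolutionOn (Iio 0) 1 0 u p → IsDiscretelySelfSimilar c u → HasTypeIDecay C₀ u →
          ∀ t < 0, ∀ x, u t x = 0) ↔
    chaeWolf2017_removing_dss :=
  ⟨chaeWolf_of_analyticWindowRungExists, fun hcw => analyticWindowRungExists_of_chaeWolf hcw hS2⟩

/-- **Modulo S2's conclusion the ∃-rung of record holds by the tree theorem Chae–Wolf 1.3 alone** — no S1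
(`gevreyFlatness_holds`), no slice dictionary, no `flatOnBall_of_window` / apex–Liouville chain. [folklore] -/
theorem analyticWindowRungExists_of_profileGevreyBoundExists
    (hS2 : ∀ C₀ : ℝ, 0 < C₀ → ∀ R : ℝ, 0 < R → ∃ C₁ θ : ℝ, 1 ≤ C₁ ∧ 0 < θ ∧ θ ≤ 1 ∧
      ProfileGevreyBound C₀ R C₁ θ) :
    ∀ C₀ : ℝ, 0 < C₀ → ∃ δ₀ θ C₁ Cp s₀ : ℝ,
      OneSliceThresholdAt C₀ δ₀ Cp s₀ ∧ AnnulusPressure C₀ Cp ∧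
      ProfileGevreyBound C₀ (2 * Real.exp (s₀ / 2)) C₁ θ ∧
      0 < δ₀ ∧ δ₀ ≤ 1 ∧ 0 < θ ∧ θ ≤ 1 ∧ 1 ≤ C₁ ∧ 0 < Cp ∧ 1 ≤ s₀ ∧
      ∀ c : ℝ, 1 < c → c ≤ Real.exp (θ / (4 * Real.log (9 * C₁ / (θ * δ₀)))) →
        ∀ (u : ℝ → EuclideanSpace ℝ (Fin 3) → EuclideanSpace ℝ (Fin 3))
          (p : ℝ → EuclideanSpace ℝ (Fin 3) → ℝ),
          IsClassicalNSSolutionOn (Iio 0) 1 0 u p → IsDiscretelySelfSimilar c u → HasTypeIDecay C₀ u →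
          ∀ t < 0, ∀ x, u t x = 0 :=
  analyticWindowRungExists_of_chaeWolf chaeWolf2017_removing_dss_holds hS2

end Summit.NavierStokesRegularity.NavierStokesRegularity.Theorems.TypeIQuantSubcubicExp.Negative
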